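import Summits.CriticalPhenomena.CardyFormulaZ2.Theorems.CardyUniqueLimitCardyRigidityPercDrivingTailOfG2
import Literature.Probability.Percolation.InterfaceTraversalBoundData4
import Literature.Probability.RandomPlanarGeometry.SLEConvergenceCriterion
import HarnessLib

/-!
# The driving tails of the bond-`ℤ²` interfaces from Condition G2 in `ℍ` of their subsequential limits
(line `crossing-martingale`, crux `CardyRigidity`, stub A2 `stub_percDrivingTail`)

Crux `Summit.CriticalPhenomena.CardyFormulaZ2.Theses.CardyUniqueLimit.CardyRigidity`
(stmt-CriticalPhenomena-0746), line `crossing_martingale`, stub A2 `stub_percDrivingTail`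
(`∀ D E, ZdDiscretisationFamily D E → Driver.PercDrivingTail D E`).  The companion file
`…PercDrivingTailOfG2` derives the conclusion of `PercDrivingTail` (eventually-uniform
sub-exponential tails of `sup_{s ≤ t} |drivingFunction φ_k (bondInterfaceIn D (E δ_k)) s|`) from
Condition G2 in `ℍ` for the laws of the pulled-back interfaces AT EACH SCALE, through the
abstract approximating maps `φ_k`.  Here the same conclusion is derived from Condition G2 in `ℍ`
for the SUBSEQUENTIAL LIMITS only, read through the fixed chordal map `φ` of `(D; a, b)` — an
intrinsic statement about `(D, E, φ)` (Kemppainen–Smirnov: Condition G2 passes to weak limits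
and is conformally invariant, Ann. Probab. 45 (2017), §2.2–2.3), insensitive to the choice of
the approximating domains `D_k ⊇ γ_k`:

* `TailShape.le_measure_comp_ge_of_tendstoInDistribution_of_frequently` — portmanteau for the
  closed set `{a ≤ g}`: if `X_i → Z` in distribution and frequently `B ≤ P_i(a ≤ g(X_i))`, then
  `B ≤ P(a ≤ g(Z))`;
* `Driver.percDrivingTail_of_limitTail` — for a discretisation family `E` of `D`, a chordal
  `φ`, positive meshes `δ_k → 0`, approximating chordal maps with (U1), (U2), `b_k → b` and box
  tightness: IF for every `t` some `K`, `r > 0` bound `μ{∃ s ≤ t, n ≤ |drivingFunction φ c s|} ≤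
  K e^{-r n}` for EVERY subsequential limit law `μ` of the interfaces (`IsSubseqLimitLaw`)
  carried by describable curves from `a` — Kemppainen–Smirnov's Thm. 1.5 (v) for the limits —
  THEN the conclusion of `Driver.PercDrivingTail D E` holds for the system.  Proof: if at level
  `n` the doubled bound failed along a subsequence, Aizenman–Burchard tightness
  (`ZdDiscretisationFamily.isTightAlongMesh_bondInterfaceIn`) and Prokhorov
  (`IsTightAlongMesh.exists_subseq`) give a further subsequence converging to a subsequential
  limit `μ`; the deterministic half of Kemppainen–Smirnov in approximating domains
  (`ae_isLoewnerDescribable_and_tendstoInDistribution_drivingPath_varying`) makes `μ`-a.e. class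
  describable and the discrete driving paths converge in law to `drivingFunction φ` under `μ`
  (sources at `a`: `ae_source_eq_of_tendsto_bondInterfaceIn`); the portmanteau theorem bounds
  the doubled bound by `μ{n ≤ sup_{[0,t]} |W|}` — a contradiction;
* `Driver.percDrivingTail_of_limitHalfPlaneG2` — the same from Condition G2 in `ℍ` (through
  `φ`, ratio `C > 1`, centres `|z₀| ≤ Z`) for the capacity truncations of the pulled-back limit
  curves `Loewner.trace (drivingFunction φ c)` under every subsequential limit (Prop. 3.7–3.8
  for the limits, `KSBridge.measure_exists_le_abs_driving_le_of_rectangleExit`);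
* `tail_percDrivingTail_of_limitTail` — registered-shape form of the first (the hypotheses of
  `Driver.PercDrivingTail` verbatim, then the limit tail bound, then its conclusion).

References: A. Kemppainen, S. Smirnov, Ann. Probab. 45 (2017), §2.2–2.3, §3.3 Prop. 3.7–3.8;
P. Billingsley, Convergence of Probability Measures (1999), Thm. 2.1, Thm. 5.1.
-/

noncomputable section

open MeasureTheory Filter Set Topology Metric
open scoped NNReal ENNReal BoundedContinuousFunction
open UpperHalfPlane (upperHalfPlaneSet)
open Literature.Probability Literature.Probability.RandomPlanarGeometry
  Literature.Probability.LatticeModels Literature.Probability.Percolation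
open scoped Literature.Probability.RandomPlanarGeometry.PathBorel
open Summit.CriticalPhenomena.CardyFormulaZ2.Cruxes.ParafermionToSLESixFamilies.CaratheodoryNetSlitUniformity
  (ae_source_eq_of_tendsto_bondInterfaceIn)

namespace Summit.CriticalPhenomena.CardyFormulaZ2.Cruxes.CardyRigidity.CrossingMartingale
-- buildfix lane 2026-08-20: namespace-local alias(es) so that short names made ambiguous by the
-- 2026-08-15 Literature migration (old home vs re-exported new home, both in the import cone) resolve,
-- as in the accepted build, to the OLD home `Literature.Probability.Percolation`. No declaration text changes.
export Literature.Probability.Percolation (bondInterfaceIn bondInterfaceIn_apply)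

namespace TailShape

variable {ι E Ω' : Type*} {Ω : ι → Type*} {mΩ : ∀ i, MeasurableSpace (Ω i)}
  {P : ∀ i, Measure (Ω i)} [∀ i, IsProbabilityMeasure (P i)] {mΩ' : MeasurableSpace Ω'}
  {μ : Measure Ω'} [IsProbabilityMeasure μ] [TopologicalSpace E] {mE : MeasurableSpace E}
  [OpensMeasurableSpace E] {X : ∀ i, Ω i → E} {Z : Ω' → E} {l : Filter ι}

/-- **Lower bounds that hold frequently pass to distributional limits through closed sets**
(portmanteau for `{a ≤ g}`): if `X_i → Z` in distribution, `g : E → ℝ` is continuous and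
frequently `B ≤ P_i {a ≤ g(X_i)}`, then `B ≤ μ {a ≤ g(Z)}` (Billingsley 1999, Thm. 2.1 (iii);
Mathlib `ProbabilityMeasure.limsup_measure_closed_le_of_tendsto`). [folklore] -/
theorem le_measure_comp_ge_of_tendstoInDistribution_of_frequently
    (h : TendstoInDistribution X l Z P μ) {g : E → ℝ} (hg : Continuous g) (a : ℝ) {B : ℝ≥0∞}
    (hB : ∃ᶠ i in l, B ≤ P i {ω | a ≤ g (X i ω)}) : B ≤ μ {ω | a ≤ g (Z ω)} := by
  haveI : l.NeBot := ⟨fun hl ↦ by simp [hl] at hB⟩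
  have h' := h.continuous_comp hg
  have hFc : IsClosed (Ici a) := isClosed_Ici
  have hZ : μ {ω | a ≤ g (Z ω)} = (μ.map (g ∘ Z)) (Ici a) := by
    rw [Measure.map_apply_of_aemeasurable h'.aemeasurable_limit hFc.measurableSet]
    rfl
  have hX : ∀ i, P i {ω | a ≤ g (X i ω)} = ((P i).map (g ∘ X i)) (Ici a) := fun i ↦ by
    rw [Measure.map_apply_of_aemeasurable (h'.forall_aemeasurable i) hFc.measurableSet]
    rfl
  have hport := ProbabilityMeasure.limsup_measure_closed_le_of_tendsto h'.tendsto hFc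
  rw [hZ]
  refine le_trans (le_limsup_of_frequently_le (hB.mono fun i hi ↦ ?_)) hport
  simpa [hX i] using hi

end TailShape

namespace Driver

/-- **The driving tails of the discrete capacity driving processes from those of the
subsequential limits** (the continuum half of Kemppainen–Smirnov's Thm. 1.5 (v) / Prop. 3.8 fed
back to the lattice by the portmanteau theorem).  For a discretisation family `E` of `D`, a
chordal `φ`, positive meshes `δ_k → 0` and approximating chordal maps `φ_k` with (U1), (U2),
`b_k → b` and box tightness: IF for every `t` there are `K`, `r > 0` such that EVERY subsequential
limit law `μ` of the interfaces (`IsSubseqLimitLaw`) which is carried by curves from `a`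
describable through `φ` satisfies `μ{∃ s ≤ t, n ≤ |drivingFunction φ c s|} ≤ K e^{-r n}` for all
`n`, THEN the conclusion of `Driver.PercDrivingTail D E` holds for the system (constants
`2 max(K,1)`, `r`, `n₀ = 0`): if at level `n` the doubled bound failed along a subsequence,
Aizenman–Burchard tightness and Prokhorov give a further subsequence converging to a
subsequential limit `μ`, the deterministic half of Kemppainen–Smirnov in approximating domains
makes `μ`-a.e. class describable with the discrete driving paths converging in law to
`drivingFunction φ` under `μ` (sources at `a` by `ae_source_eq_of_tendsto_bondInterfaceIn`), and
the portmanteau theorem for the closed set `{n ≤ sup_{[0,t]} |w|}` contradicts the hypothesis.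
[cite: KemppainenSmirnov2017, Thm. 1.5 (v) and Prop. 3.8] -/
theorem percDrivingTail_of_limitTail {D : DobrushinDomain} {E : ℝ → DiscreteDobrushin}
    (hE : ZdDiscretisationFamily D E) {φ : ConformalEquiv upperHalfPlaneSet D.carrier}
    (hφ : D.IsChordalUniformizing φ) {δs : ℕ → ℝ} (hδpos : ∀ k, 0 < δs k)
    (hδ0 : Tendsto δs atTop (𝓝 0)) {Ds : ℕ → DobrushinDomain}
    {φs : ∀ k, ConformalEquiv upperHalfPlaneSet (Ds k).carrier}
    (hφs : ∀ k, (Ds k).IsChordalUniformizing (φs k))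
    (hU1 : ∀ R : ℝ, TendstoUniformlyOn (fun k ↦ (φs k).boundaryExtension) φ.boundaryExtension
      atTop ({z : ℂ | 0 ≤ z.im} ∩ closedBall 0 R))
    (hU2 : ∀ ε : ℝ, 0 < ε → ∃ r : ℝ, ∀ᶠ k in atTop, ∀ z : ℂ, z ∈ {z : ℂ | 0 ≤ z.im} → r ≤ ‖z‖ →
      dist ((φs k).boundaryExtension z) ((Ds k).pt 1) ≤ ε)
    (hb : Tendsto (fun k ↦ (Ds k).pt 1) atTop (𝓝 (D.pt 1)))
    (hbox : ∀ ε : ℝ≥0∞, 0 < ε → ∃ (δγ δW : ℕ → ℝ) (T : ℕ → ℝ≥0), (∀ j, 0 < δγ j) ∧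
      (∀ j, 0 < δW j) ∧
      ∀ k, bondPercolation (zdGraph 2) half ((bondInterfaceIn D (E (δs k))) ⁻¹'
        ((fun p ↦ compactifiedClass (φs k).boundaryExtension ((Ds k).pt 1) p.1) ''
          {p : C(ℝ≥0, ℂ) × C(ℝ≥0, ℝ) | p ∈ generatedPairs ∧
            p.1 ∈ Process.modulusSet ({0} : Set ℂ) δγ ∧
            p.2 ∈ Process.modulusSet ({0} : Set ℝ) δW ∧
            ∀ (j : ℕ) (t : ℝ≥0), T j ≤ t → (j : ℝ) ≤ ‖p.1 t‖})ᶜ) ≤ ε)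
    (hT : ∀ t : ℝ≥0, ∃ (K r : ℝ), 0 < r ∧ ∀ μ : Measure (CurveClass ℂ), IsProbabilityMeasure μ →
      IsSubseqLimitLaw (fun δ ↦ bondInterfaceIn D (E δ)) (fun _ ↦ bondPercolation (zdGraph 2) half) μ →
      (∀ᵐ c ∂μ, IsLoewnerDescribable φ c) → (∀ᵐ c ∂μ, c.source = D.pt 0) →
      ∀ n : ℕ, μ {c | ∃ s, s ≤ t ∧ (n : ℝ) ≤ |drivingFunction φ c s|} ≤
        ENNReal.ofReal (K * Real.exp (-r * n)))
    (t : ℝ≥0) :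
    ∃ (K r : ℝ) (n₀ : ℕ), 0 < r ∧ ∀ n : ℕ, n₀ ≤ n → ∀ᶠ k in atTop,
      bondPercolation (zdGraph 2) half {ω | ∃ u, u ≤ t ∧
        (n : ℝ) < |drivingFunction (φs k) (bondInterfaceIn D (E (δs k)) ω) u|} ≤
        ENNReal.ofReal (K * Real.exp (-r * n)) := by
  set Pc : Measure (BondConfig (Site 2)) := bondPercolation (zdGraph 2) half with hPc
  haveI hPcI : IsProbabilityMeasure Pc := by rw [hPc]; infer_instance
  set Y : ∀ k : ℕ, BondConfig (Site 2) → CurveClass ℂ := fun k ↦ bondInterfaceIn D (E (δs k))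
    with hYdef
  have hYm : ∀ k, AEMeasurable (Y k) Pc := fun k ↦ (measurable_bondInterfaceIn D _).aemeasurable
  obtain ⟨K, r, hr, hTt⟩ := hT t
  refine ⟨2 * max K 1, r, 0, hr, fun n _ ↦ ?_⟩
  -- the continuum bound `x` and the discrete level `2x`
  set x : ℝ := max K 1 * Real.exp (-r * n) with hxdef
  have hx : 0 < x := by positivity
  have hKx : 2 * max K 1 * Real.exp (-r * n) = 2 * x := by rw [hxdef]; ring
  rw [hKx]
  by_contra hnot
  -- frequently in `k` the bound fails: extract a subsequence `ψ`
  have hfreq : ∃ᶠ k in atTop, ENNReal.ofReal (2 * x) < Pc {ω | ∃ u', u' ≤ t ∧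
      (n : ℝ) < |drivingFunction (φs k) (Y k ω) u'|} := by
    simpa only [not_eventually, not_le] using hnot
  obtain ⟨ψ, hψ, hψbad⟩ := extraction_of_frequently_atTop hfreq
  -- tightness (Aizenman–Burchard) and Prokhorov along `δs ∘ ψ`
  have hs : Tendsto (δs ∘ ψ) atTop (𝓝[>] (0 : ℝ)) :=
    tendsto_nhdsWithin_iff.2 ⟨hδ0.comp hψ.tendsto_atTop, Eventually.of_forall fun j ↦ hδpos _⟩
  have hmeasY : ∀ᶠ δ in 𝓝[>] (0 : ℝ), AEMeasurable (bondInterfaceIn D (E δ)) Pc :=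
    Eventually.of_forall fun δ ↦ (measurable_bondInterfaceIn D (E δ)).aemeasurable
  obtain ⟨θ, μ, hθ, hμ, hlimθ⟩ :=
    hE.isTightAlongMesh_bondInterfaceIn.exists_subseq (P := fun _ ↦ Pc) hmeasY hs
  haveI := hμ
  set κ : ℕ → ℕ := fun j ↦ ψ (θ j) with hκdef
  have hκmono : StrictMono κ := hψ.comp hθ
  have hκ : Tendsto κ atTop atTop := hκmono.tendsto_atTop
  have hsκ : Tendsto (fun j ↦ δs (κ j)) atTop (𝓝[>] (0 : ℝ)) := hs.comp hθ.tendsto_atTop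
  have hlimκ : ∀ f : CurveClass ℂ →ᵇ ℝ,
      Tendsto (fun j ↦ ∫ ω, f (Y (κ j) ω) ∂Pc) atTop (𝓝 (∫ c, f c ∂μ)) := hlimθ
  -- `μ` is a subsequential limit law, carried by curves from `a`
  have hsub : IsSubseqLimitLaw (fun δ ↦ bondInterfaceIn D (E δ)) (fun _ ↦ Pc) μ :=
    ⟨fun j ↦ δs (κ j), hsκ, hlimκ⟩
  have hsrc : ∀ᵐ c ∂μ, c.source = D.pt 0 :=
    ae_source_eq_of_tendsto_bondInterfaceIn D E hE (fun j ↦ δs (κ j)) hsκ μ hlimκ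
  -- the laws along `κ`, weak convergence and box tightness in law form
  set μs : ℕ → Measure (CurveClass ℂ) := fun j ↦ Pc.map (Y (κ j)) with hμsdef
  haveI hμsP : ∀ j, IsProbabilityMeasure (μs j) := fun j ↦
    Measure.isProbabilityMeasure_map (hYm (κ j))
  have hlim' : ∀ f : CurveClass ℂ →ᵇ ℝ,
      Tendsto (fun j ↦ ∫ c, f c ∂μs j) atTop (𝓝 (∫ c, f c ∂μ)) := by
    intro f
    have hint : ∀ j, ∫ c, f c ∂μs j = ∫ ω, f (Y (κ j) ω) ∂Pc := fun j ↦
      integral_map (hYm (κ j)) f.continuous.aestronglyMeasurable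
    simp_rw [hint]
    exact hlimκ f
  have hbox' : ∀ ε : ℝ≥0∞, 0 < ε → ∃ (δγ δW : ℕ → ℝ) (T : ℕ → ℝ≥0), (∀ j, 0 < δγ j) ∧
      (∀ j, 0 < δW j) ∧
      ∀ j, μs j ((fun p ↦ compactifiedClass (φs (κ j)).boundaryExtension ((Ds (κ j)).pt 1) p.1) ''
        {p : C(ℝ≥0, ℂ) × C(ℝ≥0, ℝ) | p ∈ generatedPairs ∧
          p.1 ∈ Process.modulusSet ({0} : Set ℂ) δγ ∧ p.2 ∈ Process.modulusSet ({0} : Set ℝ) δW ∧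
          ∀ (i : ℕ) (t : ℝ≥0), T i ≤ t → (i : ℝ) ≤ ‖p.1 t‖})ᶜ ≤ ε := by
    intro ε hε
    obtain ⟨δγ, δW, T, hδγ, hδW, hall⟩ := hbox ε hε
    refine ⟨δγ, δW, T, hδγ, hδW, fun j ↦ ?_⟩
    set 𝒦 : Set (C(ℝ≥0, ℂ) × C(ℝ≥0, ℝ)) := {p | p ∈ generatedPairs ∧
      p.1 ∈ Process.modulusSet ({0} : Set ℂ) δγ ∧ p.2 ∈ Process.modulusSet ({0} : Set ℝ) δW ∧
      ∀ (i : ℕ) (t : ℝ≥0), T i ≤ t → (i : ℝ) ≤ ‖p.1 t‖} with h𝒦def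
    have h𝒦 : IsCompact 𝒦 := isCompact_pairBox hδγ hδW T
    have htrans : ∀ r : ℝ, ∃ T' : ℝ≥0, ∀ p ∈ 𝒦, ∀ t, T' ≤ t → r ≤ ‖p.1 t‖ := fun r ↦
      ⟨T ⌈r⌉₊, fun p hp t ht ↦ (Nat.le_ceil r).trans (hp.2.2.2 _ t ht)⟩
    have hclosed : IsClosed ((fun p ↦ compactifiedClass (φs (κ j)).boundaryExtension
        ((Ds (κ j)).pt 1) p.1) '' 𝒦) :=
      (isClosed_image_and_continuousOn_drivingPath (hφs (κ j)) h𝒦 (fun p hp ↦ hp.1) htrans).2.2.1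
    change (Pc.map (Y (κ j))) _ ≤ ε
    rw [Measure.map_apply_of_aemeasurable (hYm (κ j)) hclosed.measurableSet.compl]
    exact hall (κ j)
  -- Kemppainen–Smirnov's deterministic half in approximating domains along `κ`
  obtain ⟨hdesc, hTD⟩ :=
    ae_isLoewnerDescribable_and_tendstoInDistribution_drivingPath_varying hφ (fun j ↦ hφs (κ j))
      (fun R v hv ↦ hκ.eventually (hU1 R v hv))
      (fun ε hε ↦ (hU2 ε hε).imp fun r hr ↦ hκ.eventually hr)
      (hb.comp hκ) hlim' hbox'
  have hTD' := tendstoInDistribution_comp_of_map_eq (P := fun _ ↦ Pc) hTD (fun j ↦ Y (κ j))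
    (fun j ↦ hYm (κ j)) fun j ↦ rfl
  -- the continuum bound for `μ`
  have hcont : μ {c | ∃ s, s ≤ t ∧ (n : ℝ) ≤ |drivingFunction φ c s|} ≤ ENNReal.ofReal x :=
    (hTt μ hμ hsub hdesc hsrc n).trans (ENNReal.ofReal_le_ofReal (by
      rw [hxdef]; gcongr; exact le_max_left _ _))
  -- portmanteau: the level `2x` survives in the limit
  haveI := isCompact_iff_compactSpace.1 (isCompact_Icc (a := (0 : ℝ≥0)) (b := t))
  set g : C(ℝ≥0, ℝ) → ℝ := fun w ↦ ‖w.restrict (Icc (0 : ℝ≥0) t)‖ with hgdef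
  have hg : Continuous g := Process.continuous_norm_restrict_Icc t
  have hfreq' : ∃ᶠ j in atTop, ENNReal.ofReal (2 * x) ≤ (fun _ ↦ Pc) j {ω | (n : ℝ) ≤
      g (⟨fun v ↦ drivingFunction (φs (κ j)) (Y (κ j) ω) v,
        continuous_drivingFunction (φs (κ j)) (Y (κ j) ω)⟩ : C(ℝ≥0, ℝ))} := by
    refine Frequently.of_forall fun j ↦ (hψbad (θ j)).le.trans (measure_mono fun ω hω ↦ ?_)
    obtain ⟨u', hu', hlt⟩ := hω
    exact (hlt.trans_le (Process.abs_apply_le_norm_restrict_Icc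
      (⟨fun v ↦ drivingFunction (φs (κ j)) (Y (κ j) ω) v,
        continuous_drivingFunction (φs (κ j)) (Y (κ j) ω)⟩ : C(ℝ≥0, ℝ)) hu')).le
  have hlimit := TailShape.le_measure_comp_ge_of_tendstoInDistribution_of_frequently hTD' hg n hfreq'
  -- `{n ≤ sup_{[0,t]} |W|} ⊆ {∃ s ≤ t, n ≤ |W s|}` (the supremum is attained)
  have hattain : μ {c | (n : ℝ) ≤ g (⟨drivingFunction φ c, continuous_drivingFunction φ c⟩ :
      C(ℝ≥0, ℝ))} ≤ μ {c | ∃ s, s ≤ t ∧ (n : ℝ) ≤ |drivingFunction φ c s|} := by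
    refine measure_mono fun c hc ↦ ?_
    set w : C(ℝ≥0, ℝ) := ⟨drivingFunction φ c, continuous_drivingFunction φ c⟩ with hw
    obtain ⟨s₀, hs₀, hmax⟩ := (isCompact_Icc : IsCompact (Icc (0 : ℝ≥0) t)).exists_isMaxOn
      (nonempty_Icc.2 bot_le) (continuous_abs.comp w.continuous).continuousOn
    have hnorm : g w ≤ |w s₀| := by
      refine (ContinuousMap.norm_le _ (abs_nonneg _)).2 fun s ↦ ?_
      simpa using hmax s.2
    exact ⟨s₀, hs₀.2, le_trans hc hnorm⟩
  -- contradiction: `2x ≤ x` with `0 < x`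
  have hchain : ENNReal.ofReal (2 * x) ≤ ENNReal.ofReal x :=
    hlimit.trans (hattain.trans hcont)
  have hlt : ENNReal.ofReal x < ENNReal.ofReal (2 * x) :=
    (ENNReal.ofReal_lt_ofReal_iff (by linarith)).2 (by linarith)
  exact absurd hchain (not_le.2 hlt)

/-- **The driving tails of the bond-`ℤ²` interfaces from Condition G2 in `ℍ` of their
subsequential limits** (Kemppainen–Smirnov Prop. 3.7–3.8 applied to the LIMITS —
`KSBridge.measure_exists_le_abs_driving_le_of_rectangleExit` on `(CurveClass ℂ, μ)` with
`W = drivingFunction φ`, `γ̂ = Loewner.trace W` — then `percDrivingTail_of_limitTail`).  The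
crossing bound is asked, with one ratio `C > 1`, for the law under each subsequential limit `μ`
of a measurable choice of classes of the capacity-`u` truncations `γ̂|[0, u]`, at the real centres
`|z₀| ≤ Z`, for every `u`, `Z`. [cite: KemppainenSmirnov2017, §2.2 and Prop. 3.7–3.8] -/
theorem percDrivingTail_of_limitHalfPlaneG2 {D : DobrushinDomain} {E : ℝ → DiscreteDobrushin}
    (hE : ZdDiscretisationFamily D E) {φ : ConformalEquiv upperHalfPlaneSet D.carrier}
    (hφ : D.IsChordalUniformizing φ) {δs : ℕ → ℝ} (hδpos : ∀ k, 0 < δs k)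
    (hδ0 : Tendsto δs atTop (𝓝 0)) {Ds : ℕ → DobrushinDomain}
    {φs : ∀ k, ConformalEquiv upperHalfPlaneSet (Ds k).carrier}
    (hφs : ∀ k, (Ds k).IsChordalUniformizing (φs k))
    (hU1 : ∀ R : ℝ, TendstoUniformlyOn (fun k ↦ (φs k).boundaryExtension) φ.boundaryExtension
      atTop ({z : ℂ | 0 ≤ z.im} ∩ closedBall 0 R))
    (hU2 : ∀ ε : ℝ, 0 < ε → ∃ r : ℝ, ∀ᶠ k in atTop, ∀ z : ℂ, z ∈ {z : ℂ | 0 ≤ z.im} → r ≤ ‖z‖ →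
      dist ((φs k).boundaryExtension z) ((Ds k).pt 1) ≤ ε)
    (hb : Tendsto (fun k ↦ (Ds k).pt 1) atTop (𝓝 (D.pt 1)))
    (hbox : ∀ ε : ℝ≥0∞, 0 < ε → ∃ (δγ δW : ℕ → ℝ) (T : ℕ → ℝ≥0), (∀ j, 0 < δγ j) ∧
      (∀ j, 0 < δW j) ∧
      ∀ k, bondPercolation (zdGraph 2) half ((bondInterfaceIn D (E (δs k))) ⁻¹'
        ((fun p ↦ compactifiedClass (φs k).boundaryExtension ((Ds k).pt 1) p.1) ''
          {p : C(ℝ≥0, ℂ) × C(ℝ≥0, ℝ) | p ∈ generatedPairs ∧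
            p.1 ∈ Process.modulusSet ({0} : Set ℂ) δγ ∧
            p.2 ∈ Process.modulusSet ({0} : Set ℝ) δW ∧
            ∀ (j : ℕ) (t : ℝ≥0), T j ≤ t → (j : ℝ) ≤ ‖p.1 t‖})ᶜ) ≤ ε)
    {C : ℝ} (hC : 1 < C)
    (hG : ∀ μ : Measure (CurveClass ℂ), IsProbabilityMeasure μ →
      IsSubseqLimitLaw (fun δ ↦ bondInterfaceIn D (E δ)) (fun _ ↦ bondPercolation (zdGraph 2) half) μ →
      ∀ u : ℝ≥0, 0 < u → ∀ Z : ℝ, ∃ crv : CurveClass ℂ → CurveClass ℂ, AEMeasurable crv μ ∧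
        (∀ᵐ c ∂μ, (crv c).source = 0 ∧
          (crv c).range = (Loewner.trace (drivingFunction φ c)) '' Icc 0 u) ∧
        ∀ F : Set ℂ, IsClosed F → F.Nonempty → ∀ z₀ : ℝ, |z₀| ≤ Z →
          ∀ S : Set (CurveClass ℂ), MeasurableSet S →
          S ⊆ {p | Disjoint p.range (ball ((z₀ : ℝ) : ℂ) (C * (2 * Real.sqrt u)))} →
          μ.map crv (CurveClass.stopAt F ⁻¹' S ∩
              {c | c.startFrom F ∈ CurveClass.crossingIn ((z₀ : ℝ) : ℂ) (2 * Real.sqrt u)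
                (C * (2 * Real.sqrt u)) univ}) ≤
            2⁻¹ * μ.map crv (CurveClass.stopAt F ⁻¹' S))
    (t : ℝ≥0) :
    ∃ (K r : ℝ) (n₀ : ℕ), 0 < r ∧ ∀ n : ℕ, n₀ ≤ n → ∀ᶠ k in atTop,
      bondPercolation (zdGraph 2) half {ω | ∃ u, u ≤ t ∧
        (n : ℝ) < |drivingFunction (φs k) (bondInterfaceIn D (E (δs k)) ω) u|} ≤
        ENNReal.ofReal (K * Real.exp (-r * n)) := by
  refine percDrivingTail_of_limitTail hE hφ hδpos hδ0 hφs hU1 hU2 hb hbox (fun t' ↦ ?_) t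
  set u : ℝ≥0 := t' + 1 with hudef
  have hu : 0 < u := by positivity
  set c : ℝ := Real.log 2 / (2 * C) with hcdef
  have hC0 : 0 < C := zero_lt_one.trans hC
  have hc : 0 < c := by
    have := Real.log_pos one_lt_two
    positivity
  refine ⟨4 * Real.exp (2 * c), c / (581 * Real.sqrt u), by positivity, fun μ hμ hsub hdesc hsrc n ↦ ?_⟩
  haveI := hμ
  obtain ⟨crv, hcrv, hrep, hGμ⟩ := hG μ hμ hsub u hu ((n : ℝ) / 581)
  have hpair : ∀ᵐ c ∂μ, Loewner.IsGeneratedByCurve (drivingFunction φ c)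
      (Loewner.trace (drivingFunction φ c)) ∧ Continuous (drivingFunction φ c) ∧
      drivingFunction φ c 0 = 0 := by
    filter_upwards [hdesc, hsrc] with c hd hs
    exact ⟨(isLoewnerDescribed_drivingFunction hd).exists_eq_mk_trace.1,
      continuous_drivingFunction φ c, drivingFunction_apply_zero hφ hs⟩
  have hcont := KSBridge.measure_exists_le_abs_driving_le_of_rectangleExit μ hpair hu hC crv hcrv
    hrep n hGμ
  rw [← hcdef] at hcont
  have hincl : μ {c | ∃ s, s ≤ t' ∧ (n : ℝ) ≤ |drivingFunction φ c s|} ≤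
      μ {c | ∃ s ≤ u, (n : ℝ) ≤ |drivingFunction φ c s|} :=
    measure_mono fun c ⟨s, hs, hle⟩ ↦ ⟨s, hs.trans (by rw [hudef]; exact le_self_add), hle⟩
  refine hincl.trans (hcont.trans (le_of_eq ?_))
  congr 1
  have hexp : -(c / 581 * (n : ℝ) / Real.sqrt u) = -(c / (581 * Real.sqrt u)) * n := by ring
  rw [hexp]

end Driver

/-- **Registered-shape form** (glue sub-goal `tail_percDrivingTail_of_limitTail` of
stmt-CriticalPhenomena-0746): the hypotheses of `Driver.PercDrivingTail D E` verbatim and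
eventually-uniform sub-exponential tails of `sup_{[0,t]} |drivingFunction φ|` under EVERY
subsequential limit law of the interfaces of `(D, E)` carried by describable curves from `a`
(Kemppainen–Smirnov's Thm. 1.5 (v) for this family) imply the conclusion of
`Driver.PercDrivingTail D E`. [cite: KemppainenSmirnov2017, Thm. 1.5 (v) and Prop. 3.8] -/
theorem tail_percDrivingTail_of_limitTail : ∀ (D : DobrushinDomain) (E : ℝ → DiscreteDobrushin), ZdDiscretisationFamily D E → ∀ φ : ConformalEquiv upperHalfPlaneSet D.carrier, D.IsChordalUniformizing φ → ∀ δs : ℕ → ℝ, (∀ k, 0 < δs k) → Tendsto δs atTop (𝓝 0) → (∀ k, (E (δs k)).IsZdAdmissible) → ∀ (Ds : ℕ → DobrushinDomain) (φs : ∀ k, ConformalEquiv upperHalfPlaneSet (Ds k).carrier), (∀ k, (Ds k).IsChordalUniformizing (φs k)) → (∀ R : ℝ, TendstoUniformlyOn (fun k ↦ (φs k).boundaryExtension) φ.boundaryExtension atTop ({z : ℂ | 0 ≤ z.im} ∩ closedBall 0 R)) → (∀ ε : ℝ, 0 < ε → ∃ r : ℝ, ∀ᶠ k in atTop, ∀ z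 : ℂ, z ∈ {z : ℂ | 0 ≤ z.im} → r ≤ ‖z‖ → dist ((φs k).boundaryExtension z) ((Ds k).pt 1) ≤ ε) → Tendsto (fun k ↦ (Ds k).pt 1) atTop (𝓝 (D.pt 1)) → (∀ ε : ℝ≥0∞, 0 < ε → ∃ (δγ δW : ℕ → ℝ) (T : ℕ → ℝ≥0), (∀ j, 0 < δγ j) ∧ (∀ j, 0 < δW j) ∧ ∀ k, bondPercolation (zdGraph 2) half ((bondInterfaceIn D (E (δs k))) ⁻¹' ((fun p ↦ compactifiedClass (φs k).boundaryExtension ((Ds k).pt 1) p.1) '' {p : C(ℝ≥0, ℂ) × C(ℝ≥0, ℝ) | p ∈ generatedPairs ∧ p.1 ∈ Process.modulusSet ({0} : Set ℂ) δγ ∧ p.2 ∈ Process.modulusSet ({0} : Set ℝ) δW ∧ ∀ (j : ℕ) (t : ℝ≥0), T j ≤ t → (j : ℝ) ≤ ‖p.1 t‖})ᶜ) ≤ ε) → (∀ t : ℝ≥0, ∃ (K r : ℝ), 0 < r ∧ ∀ μ : Measure (CurveClass ℂ), IsProbabilityMeasure μ → IsSubseqLimitLaw (fun δ ↦ bondInterfaceIn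 D (E δ)) (fun _ ↦ bondPercolation (zdGraph 2) half) μ → (∀ᵐ c ∂μ, IsLoewnerDescribable φ c) → (∀ᵐ c ∂μ, c.source = D.pt 0) → ∀ n : ℕ, μ {c | ∃ s, s ≤ t ∧ (n : ℝ) ≤ |drivingFunction φ c s|} ≤ ENNReal.ofReal (K * Real.exp (-r * n))) → ∀ t : ℝ≥0, ∃ (K r : ℝ) (n₀ : ℕ), 0 < r ∧ ∀ n : ℕ, n₀ ≤ n → ∀ᶠ k in atTop, bondPercolation (zdGraph 2) half {ω | ∃ u, u ≤ t ∧ (n : ℝ) < |drivingFunction (φs k) (bondInterfaceIn D (E (δs k)) ω) u|} ≤ ENNReal.ofReal (K * Real.exp (-r * n)) :=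
  fun _ _ hE _ hφ _ hδpos hδ0 _ _ _ hφs hU1 hU2 hb hbox hT t ↦
    Driver.percDrivingTail_of_limitTail hE hφ hδpos hδ0 hφs hU1 hU2 hb hbox hT t

end Summit.CriticalPhenomena.CardyFormulaZ2.Cruxes.CardyRigidity.CrossingMartingale

end
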